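import Summits.BirchSwinnertonDyer.BirchSwinnertonDyer.Theses.PlecticLegs
import Literature.NumberTheory.EllipticCurves.Selmer
import Literature.NumberTheory.EllipticCurves.GaloisAction
import Literature.NumberTheory.EllipticCurves.SelmerCorankHolds
import HarnessLib

/-!
# Crux `PlecticLegs.PlecticPointsLB` (stmt-BirchSwinnertonDyer-17518), line `Sketch`, stub C `stub_ladder` —
# the `p`-converse ladder split into its `k = 1` and `k ≥ 2` slices (worker C for lead a1, 2026-08-17)

The registered stub C of `Cruxes/PlecticPointsLB/Lines/Sketch.lean` (= stub C of `Lines/selmer_ladder.lean`) reads: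
for `F` totally real, `V/F` elliptic and an ADMISSIBLE prime `p` (`5 ≤ p`, `p ∤ disc F`, `ρ̄_{V,p}` irreducible, good
ordinary above `p` — read on Mathlib's `localPolynomial`), for every `k` with `1 ≤ k ≤ [F:ℚ] − 2`:
`1 ≤ ord_{s=1} L(V/F,s)` and `corank_{ℤ_p} Sel_{p^∞}(V/F) = k` imply `ord_{s=1} L(V/F,s) = k` — "no intermediate
Selmer corank", i.e. the rank-`k` `p`-CONVERSE over `F`.

This stub is not provable today and this file does not land it. It records, sorry-free:

* `StubLadderOne` / `StubLadderGeTwo` — the `k = 1` slice (binders of the stub with `k = 1` substituted: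
  `3 ≤ [F:ℚ] → 1 ≤ r_an → s_p = 1 → r_an = 1`) and the `k ≥ 2` slice (`2 ≤ k`);
* `stub_ladder_of_slices` — the two slices give back the registered signature VERBATIM (case split on `k = 1`), and
  `stubLadder_iff_slices` — the split is lossless (`StubLadder ↔ StubLadderOne ∧ StubLadderGeTwo`);
* `stubLadderOne_of_pConverse_of_bridge` — the `k = 1` slice follows from (P) the rank-one `p`-converse to
  Gross–Zagier–Kolyvagin OVER TOTALLY REAL FIELDS in continuation form ("`L(V/F,s)` entire and
  `corank Sel_{p^∞}(V/F) = 1` ⇒ `ord_{s=1} L(V/F,s) = 1`", hypothesis `hP`, stated inline — it is NOT a tree fact,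
  see below) together with (J) the junk bridge `r_an(V) ≠ 0 → L(V/F,s)` entire (hypothesis `hJ`; over `ℚ` this is
  the tree theorem `WeierstrassCurve.hasEntireLFunction_of_analyticRank_ne_zero`, over a general number field the
  `ℚ`-argument — no absolute convergence of `∑ aₙ n⁻ˢ` at `s = 1` prime by prime — fails through cancellation among
  the primes above one rational prime, and it is kept as a hypothesis).

Status of the slices (literature search of this seat, log in `work/stubs/stub_ladder.md`):

* `k = 1` ([F:ℚ] ≥ 3): NO PRINTED THEOREM LOCATED. The rank-one `p`-converse is a theorem over `ℚ` (Skinner, Ann.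
  of Math. 191 (2020) Thm A; W. Zhang, Camb. J. Math. 2 (2014); Wan, Acta Math. Sin. 37 (2021) Thm 1.7;
  Burungale–Skinner–Tian–Wan arXiv:2409.01350 Thm 1.10 — tree facts in `BSDSelmer.lean` / `BSDSelmerPConverse*.lean`).
  Beyond `ℚ` the only located statements are (i) arXiv:2504.21799 (2025), "A `p`-converse theorem for real quadratic
  fields": `F` real QUADRATIC, `p > 5` inert, SPLIT MULTIPLICATIVE reduction at `𝔭 ∣ p`, hypotheses in rank form
  (`rank E(F) = 1 ∧ #Ш(E/F)[p^∞] < ∞ ⇒ ord = 1`), whose introduction states that all earlier `p`-converse theorems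
  "are valid for elliptic curves defined over `ℚ`" and that the general totally real case is future work — it misses
  this slice on degree (`d = 2` versus `d ≥ 3`), reduction type and hypothesis form; (ii) Burungale–Castella–Skinner–
  Tian, "`p`-converse to a theorem of Gross–Zagier and Kolyvagin: CM elliptic curves over totally real fields",
  announced 2019, cited as "preprint" in J. Number Theory (2021), Ann. Math. Québec 46 (2022) ("leads to the first
  `p`-converse theorems over general totally real fields") and Tian's ICM 2022 report, never posted (not in a
  3.1 M-document corpus as of 2026-08) — CM curves only in any case. Disegni (Invent. Math. 230 (2022), Thm A)
  proves the OPPOSITE (`p`-adic Kolyvagin) direction over `F`. So (P) is near print (ingredients: Liu–Zhang–Zhang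
  `p`-adic Waldspurger 2018, Wan 2015, Fouquet 2013 / Longo 2012, Yuan–Zhang–Zhang, Nekovář 2007) but unstated.
* `k ≥ 2` ([F:ℚ] ≥ 4): OPEN — see the docstring of `StubLadderGeTwo`.
-/

set_option linter.dupNamespace false -- single-conjunct summit: Sub = Summit (D-0017)

open NumberField IsDedekindDomain

namespace Summit.BirchSwinnertonDyer.BirchSwinnertonDyer.Theorems

/-! ## The stub and its two slices, as named statements -/

/-- The statement of the registered stub C `stub_ladder` of line `Sketch` (crux `PlecticLegs.PlecticPointsLB`),
restated by name: for `F` totally real, `V/F` elliptic, `p` admissible (`5 ≤ p`, `p ∤ disc F`, `ρ̄_{V,p}` irreducible,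
good ordinary above `p`) and `1 ≤ k ≤ [F:ℚ] − 2`: `1 ≤ r_an(V/F) → corank_{ℤ_p} Sel_{p^∞}(V/F) = k → r_an(V/F) = k`.
Byte-identical with the type of `…Cruxes.PlecticPointsLB.Sketch.stub_ladder`. -/
def StubLadder : Prop :=
  ∀ (F : Type) [Field F] [NumberField F] [NumberField.IsTotallyReal F] (V : WeierstrassCurve F)
    [V.IsElliptic] (p : ℕ) [Fact p.Prime], 5 ≤ p → ¬ ((p : ℤ) ∣ NumberField.discr F) →
    V.HasIrreducibleModPGaloisRep p →
    (∀ 𝔭 : HeightOneSpectrum (𝓞 F), (p : 𝓞 F) ∈ 𝔭.asIdeal →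
      ((V.baseChange (𝔭.adicCompletion F)).localPolynomial (𝔭.adicCompletionIntegers F)).natDegree = 2 ∧
      ¬ (p : ℤ) ∣ ((V.baseChange (𝔭.adicCompletion F)).localPolynomial
        (𝔭.adicCompletionIntegers F)).coeff 1) →
    ∀ k : ℕ, 1 ≤ k → k + 2 ≤ Module.finrank ℚ F → 1 ≤ V.analyticRank →
      V.selmerCorank p = k → V.analyticRank = k

/-- **The `k = 1` slice of stub C: the rank-one `p`-converse to Gross–Zagier–Kolyvagin over a totally real field
of degree `≥ 3`.** Same binders as the stub with `k = 1` substituted: for `F` totally real with `3 ≤ [F:ℚ]`, `V/F`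
elliptic, `p` admissible, `1 ≤ ord_{s=1} L(V/F,s)` and `corank_{ℤ_p} Sel_{p^∞}(V/F) = 1` imply
`ord_{s=1} L(V/F,s) = 1`. Over `ℚ` the analogous statement is a theorem (Skinner 2020 Thm A, W. Zhang 2014,
Wan 2021 Thm 1.7, Burungale–Skinner–Tian–Wan 2024 Thm 1.10); over totally real `F` no printed theorem was located
(module docstring; `work/stubs/stub_ladder.md`). It is implied by `p^∞`-Selmer BSD in corank `1`, and reduced below
(`stubLadderOne_of_pConverse_of_bridge`) to the continuation-form `p`-converse plus the junk bridge. -/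
def StubLadderOne : Prop :=
  ∀ (F : Type) [Field F] [NumberField F] [NumberField.IsTotallyReal F] (V : WeierstrassCurve F)
    [V.IsElliptic] (p : ℕ) [Fact p.Prime], 5 ≤ p → ¬ ((p : ℤ) ∣ NumberField.discr F) →
    V.HasIrreducibleModPGaloisRep p →
    (∀ 𝔭 : HeightOneSpectrum (𝓞 F), (p : 𝓞 F) ∈ 𝔭.asIdeal →
      ((V.baseChange (𝔭.adicCompletion F)).localPolynomial (𝔭.adicCompletionIntegers F)).natDegree = 2 ∧
      ¬ (p : ℤ) ∣ ((V.baseChange (𝔭.adicCompletion F)).localPolynomial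
        (𝔭.adicCompletionIntegers F)).coeff 1) →
    3 ≤ Module.finrank ℚ F → 1 ≤ V.analyticRank → V.selmerCorank p = 1 → V.analyticRank = 1

/-- **The `k ≥ 2` slice of stub C: the rank-`k` `p`-converse over a totally real field, `2 ≤ k ≤ [F:ℚ] − 2`
(so `[F:ℚ] ≥ 4`).** Same binders as the stub with `2 ≤ k`: `1 ≤ ord_{s=1} L(V/F,s)` and
`corank_{ℤ_p} Sel_{p^∞}(V/F) = k` imply `ord_{s=1} L(V/F,s) = k`.

WHY IT IS OPEN. For `k ≥ 2` no Euler system or Kolyvagin system is known that certifies "Selmer corank EXACTLY `k`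
⇒ analytic order EXACTLY `k`", over `ℚ` or over any totally real field: every proved `p`-converse is a rank-`0`
statement (Skinner–Urban 2014 / Wan 2015 over `F`: corank `0` ⇒ `L(1) ≠ 0`) or a rank-`1` statement (a corank-one
Selmer group forces a Heegner point or class to be non-torsion, and Gross–Zagier / Yuan–Zhang–Zhang converts that
into `ord = 1`). In corank `2` the generalised Kato classes of Darmon–Rotger reach only the direction "class `≠ 0`
⇒ `dim Sel = 2`" (Castella–Hsieh, "On the nonvanishing of generalised Kato classes for elliptic curves of rank 2",
Forum Math. Sigma 10 (2022)), and their non-vanishing is itself conjectural; no construction produces `k ≥ 2`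
independent Selmer classes from `ord_{s=1} L = k`, nor bounds the order of vanishing from above by the corank. The
slice is the totally-real twin of the `ℚ`-side frontier of route SelmerRank
(`Summit.BirchSwinnertonDyer.BirchSwinnertonDyer.Theses.SelmerRank.SelmerRankLB`, "lower bound open from
`r_an = 4`"), and it is where this line meets it: the ladder needs it exactly from `[F:ℚ] = 4` on.

WHY IT IS PLAUSIBLE. It is implied by `p^∞`-Selmer BSD over `F` in coranks `2 … [F:ℚ] − 2` (BSD gives
`rank V(F) = ord_{s=1} L(V/F,s)` and `Ш(V/F)` finite, hence `corank Sel_{p^∞}(V/F) = rank = ord` by the corank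
identity `selmerCorank_eq_mordellWeilRank_add`); a counterexample would be a counterexample to BSD over a totally
real field. Cheapest falsifier (not run): a curve over a totally real quartic field with certified
`corank Sel_{p^∞} = 2` at an admissible `p` and four vanishing conditions at `s = 1`. -/
def StubLadderGeTwo : Prop :=
  ∀ (F : Type) [Field F] [NumberField F] [NumberField.IsTotallyReal F] (V : WeierstrassCurve F)
    [V.IsElliptic] (p : ℕ) [Fact p.Prime], 5 ≤ p → ¬ ((p : ℤ) ∣ NumberField.discr F) →
    V.HasIrreducibleModPGaloisRep p →
    (∀ 𝔭 : HeightOneSpectrum (𝓞 F), (p : 𝓞 F) ∈ 𝔭.asIdeal →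
      ((V.baseChange (𝔭.adicCompletion F)).localPolynomial (𝔭.adicCompletionIntegers F)).natDegree = 2 ∧
      ¬ (p : ℤ) ∣ ((V.baseChange (𝔭.adicCompletion F)).localPolynomial
        (𝔭.adicCompletionIntegers F)).coeff 1) →
    ∀ k : ℕ, 2 ≤ k → k + 2 ≤ Module.finrank ℚ F → 1 ≤ V.analyticRank →
      V.selmerCorank p = k → V.analyticRank = k

/-! ## The split is exact -/

/-- **Stub C from its two slices**, with the registered signature verbatim: case split on `k = 1` (then
`k + 2 ≤ [F:ℚ]` is `3 ≤ [F:ℚ]` and `StubLadderOne` applies) versus `2 ≤ k` (`StubLadderGeTwo`). -/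
theorem stub_ladder_of_slices (h1 : StubLadderOne) (h2 : StubLadderGeTwo) :
    ∀ (F : Type) [Field F] [NumberField F] [NumberField.IsTotallyReal F] (V : WeierstrassCurve F)
      [V.IsElliptic] (p : ℕ) [Fact p.Prime], 5 ≤ p → ¬ ((p : ℤ) ∣ NumberField.discr F) →
      V.HasIrreducibleModPGaloisRep p →
      (∀ 𝔭 : HeightOneSpectrum (𝓞 F), (p : 𝓞 F) ∈ 𝔭.asIdeal →
        ((V.baseChange (𝔭.adicCompletion F)).localPolynomial (𝔭.adicCompletionIntegers F)).natDegree = 2 ∧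
        ¬ (p : ℤ) ∣ ((V.baseChange (𝔭.adicCompletion F)).localPolynomial
          (𝔭.adicCompletionIntegers F)).coeff 1) →
      ∀ k : ℕ, 1 ≤ k → k + 2 ≤ Module.finrank ℚ F → 1 ≤ V.analyticRank →
        V.selmerCorank p = k → V.analyticRank = k := by
  intro F _ _ _ V _ p _ h5 hdisc hirr hord k hk hkd hpos hs
  rcases Nat.lt_or_ge k 2 with hlt | hge
  · obtain rfl : k = 1 := by omega
    exact h1 F V p h5 hdisc hirr hord (by omega) hpos hs
  · exact h2 F V p h5 hdisc hirr hord k hge hkd hpos hs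

/-- `stub_ladder_of_slices`, concluding the named statement `StubLadder`. -/
theorem stubLadder_of_slices (h1 : StubLadderOne) (h2 : StubLadderGeTwo) : StubLadder :=
  stub_ladder_of_slices h1 h2

/-- The `k = 1` slice is a special case of the stub. -/
theorem stubLadderOne_of_stubLadder (h : StubLadder) : StubLadderOne :=
  fun F _ _ _ V _ p _ h5 hdisc hirr hord hd hpos hs => h F V p h5 hdisc hirr hord 1 le_rfl hd hpos hs

/-- The `k ≥ 2` slice is a special case of the stub. -/
theorem stubLadderGeTwo_of_stubLadder (h : StubLadder) : StubLadderGeTwo :=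
  fun F _ _ _ V _ p _ h5 hdisc hirr hord k hk hkd hpos hs =>
    h F V p h5 hdisc hirr hord k (by omega) hkd hpos hs

/-- **The split of stub C is lossless**: `StubLadder ↔ StubLadderOne ∧ StubLadderGeTwo`. -/
theorem stubLadder_iff_slices : StubLadder ↔ StubLadderOne ∧ StubLadderGeTwo :=
  ⟨fun h => ⟨stubLadderOne_of_stubLadder h, stubLadderGeTwo_of_stubLadder h⟩,
    fun h => stubLadder_of_slices h.1 h.2⟩

/-! ## What the `k = 1` slice reduces to -/

/-- **The `k = 1` slice from the totally-real rank-one `p`-converse (continuation form) and the junk bridge.**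
Hypothesis `hP` is the statement a printed "`p`-converse to Gross–Zagier–Kolyvagin over totally real fields" would
transcribe to, in the stub's vocabulary and with the stub's admissibility conditions: for `F` totally real, `V/F`
elliptic, `p` admissible, IF `L(V/F,s)` has an entire continuation (`V.HasEntireLFunction` — the shadow of the
modularity hypothesis every printed version will carry; for `[F:ℚ] ≤ 3` all `V` are modular, Freitas–Le Hung–Siksek
2015 / Derickx–Najman–Siksek 2020, tree facts `FLS2015_theorem1`, `DNS2020_theorem4`) and
`corank_{ℤ_p} Sel_{p^∞}(V/F) = 1`, THEN `ord_{s=1} L(V/F,s) = 1`. NO PRINTED THEOREM STATES `hP` (module docstring):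
it is a hypothesis here, not a tree fact, and nothing is claimed about it. Hypothesis `hJ` is the junk bridge
`r_an ≠ 0 → L entire` (a theorem over `ℚ`, `WeierstrassCurve.hasEntireLFunction_of_analyticRank_ne_zero`; open
bookkeeping over `F`). Given both, `1 ≤ r_an` certifies the continuation and `hP` concludes; the degree hypothesis
`3 ≤ [F:ℚ]` is not used. -/
theorem stubLadderOne_of_pConverse_of_bridge
    (hP : ∀ (F : Type) [Field F] [NumberField F] [NumberField.IsTotallyReal F] (V : WeierstrassCurve F)
      [V.IsElliptic] (p : ℕ) [Fact p.Prime], 5 ≤ p → ¬ ((p : ℤ) ∣ NumberField.discr F) →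
      V.HasIrreducibleModPGaloisRep p →
      (∀ 𝔭 : HeightOneSpectrum (𝓞 F), (p : 𝓞 F) ∈ 𝔭.asIdeal →
        ((V.baseChange (𝔭.adicCompletion F)).localPolynomial (𝔭.adicCompletionIntegers F)).natDegree = 2 ∧
        ¬ (p : ℤ) ∣ ((V.baseChange (𝔭.adicCompletion F)).localPolynomial
          (𝔭.adicCompletionIntegers F)).coeff 1) →
      V.HasEntireLFunction → V.selmerCorank p = 1 → V.analyticRank = 1)
    (hJ : ∀ (F : Type) [Field F] [NumberField F] (V : WeierstrassCurve F) [V.IsElliptic],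
      V.analyticRank ≠ 0 → V.HasEntireLFunction) :
    StubLadderOne := by
  intro F _ _ _ V _ p _ h5 hdisc hirr hord _hd hpos hs
  exact hP F V p h5 hdisc hirr hord (hJ F V (by omega)) hs

end Summit.BirchSwinnertonDyer.BirchSwinnertonDyer.Theorems
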